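import Summits.BirchSwinnertonDyer.Rank1Residual.Supersingular.MazurTateConstantTermsMu
import HarnessLib

/-!
# The trivial-character column modulo `p` at ANY good odd prime: `θ_{n+1}(0)/[0]⁺_f ≡ a_pⁿ(a_p − 1)² (mod p)`
# — ordinary non-anomalous: a `p`-UNIT at every layer (so `μ(Θ_{n+1}) ≤ ord_p(ϖ[0]⁺_f)`); ANOMALOUS
# `a_p ≡ 1`: divisible by `p` at every layer `n + 1 ≥ 1`; supersingular: divisible by `p` from layer `2` on
# (cell `b2b-bsdres`; prover B = unit `b2b-bsdres-additive-p3`, gen 11, part 3 — class-agnostic, for the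
# ordinary / Eisenstein census of iw-1, x1a/x1b, eisenstein-p1, x9, x10, x11a as much as for X6/X7/X8)

HONEST FRAMING (run/shared/lean/b2b/bsd-rank1-residual/, verbatim in every file): the goal of the
cell is to DELETE the COMBINATION-SHAPED residual classes of the Birch–Swinnerton-Dyer formula for
ALL analytic-rank `≤ 1` elliptic curves over `ℚ` — "full BSD formula for every rank `≤ 1` curve in
class `C`" assembled STRICTLY from published theorems — so that the rank-`≤ 1` remainder becomes
exactly the CONSTRUCTION-SHAPED classes, which are TYPED (missing-input `Prop`s), NOT attempted.
This is not "finishing BSD". THEOREMS ONLY (no definition, no named fact, no `sorry`): elementary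
algebra over the tree's REAL objects (`θ_n = mazurTateElement f p n`, `[0]⁺_f = ratPlusSymbol f 0`,
the cell's `μ` on `Λ`); nothing about any particular curve is asserted; nothing is booked; no label
is touched (X1/X2/X9/X10/X11/X6/X7/X8 unchanged).

## What this file proves, and why (memo `HOME/b2b-bsdres-additive-p3/X8-ROUTE-B.md` §16)

Part 1 (`MazurTateConstantTerms.lean`, p235222) solved the trivial-character column of the Mazur–Tate
elements of a rational newform at ANY prime `p ∤ 2N`: `θ_{n+1}(0) = e_{n+1}·[0]⁺_f`,
`e_{n+1} = c_{n+2} − 2c_{n+1} + c_n`, `c` the Hecke descent sequence (`c_0 = 1, c_1 = a_p,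
c_{j+2} = a_p c_{j+1} − p c_j`). Since `c_j ≡ a_p^j (mod p)` (gen 9), the column is KNOWN MODULO `p` in
all three regimes at once:
* §1 **`e_{n+1} ≡ a_pⁿ·(a_p − 1)² (mod p)` for every `n`** (`heckeDescentSeq_secondDiff_zmod`); hence
  **ordinary NON-anomalous (`p ∤ a_p`, `a_p ≢ 1`): `p ∤ e_{n+1}` at EVERY layer**; **anomalous
  (`a_p ≡ 1 (mod p)`): `p ∣ e_{n+1}` at every layer `n + 1 ≥ 1`** (while `e_0 = a_p − 2 ≡ −1` is a unit)
  — the finite-layer shadow of the `p`-adic multiplier `(1 − α⁻¹)²` of Mazur–Tate–Teitelbaum; and the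
  supersingular `p ∣ e_{n+2}` of part 1 is the case `a_p ≡ 0`.
* §2 on the real objects (`p ∤ 2N`, `L(f,1) ≠ 0`): ordinary non-anomalous ⇒ **`θ_{n+1}(0)` is a
  `p`-UNIT multiple of `[0]⁺_f`**, so an integral model `Θ` of `ϖ·θ_{n+1}` has
  **`μ(Θ) ≤ ord_p ϖ + ord_p [0]⁺_f` at EVERY layer** (`mazurTate_mu_le_of_not_anomalous`) — no `μ` can
  hide behind the trivial character; anomalous ⇒ **`θ_{n+1}(0) ∈ p·e'·[0]⁺_f`** with `e' ∈ ℤ`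
  (`eval_zero_mazurTateElement_succ_of_anomalous`): at an anomalous (e.g. X1, Eisenstein) good prime
  the trivial-character value of every `θ_{n+1}` carries an EXTRA factor `p` — the census must read
  `μ`/`λ` of `θ_n` off other coefficients there (as iw-1 / x1a do).

For iw-1 / x1a / x1b / eisenstein-p1 / x9 / x10 / x11a: a free exact per-row column `e_{n+1} mod p =
a_pⁿ(a_p−1)² mod p` and, at non-anomalous ordinary rows of analytic rank `0`, the bound
`μ(θ_{n+1}) ≤ ord_p(ϖ·[0]⁺)`. Analytic side only; nothing booked.

References: B. Mazur, J. Tate, J. Teitelbaum, Invent. Math. 84 (1986) §I.8 (8.6), §I.10 (10.2), §I.14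
(the `p`-adic multiplier) [MazurTateTeitelbaum1986Invent]; B. Mazur, Invent. Math. 18 (1972) §1
(anomalous primes) [Mazur1972]; R. Greenberg, V. Vatsal, Invent. Math. 142 (2000) p. 2 (2)
[GreenbergVatsal2000]. Memo: `HOME/b2b-bsdres-additive-p3/X8-ROUTE-B.md` §16 (gen 11).
-/

set_option autoImplicit false

noncomputable section

open scoped Classical MatrixGroups ModularForm

open CongruenceSubgroup Polynomial WeierstrassCurve Literature.NumberTheory.EllipticCurves
  Literature.NumberTheory.EllipticCurves.ModularForms
  Literature.NumberTheory.EllipticCurves.Sprung2017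
  Literature.NumberTheory.EllipticCurves.Rank1Residual
  Summit.BirchSwinnertonDyer.Rank1Residual.X1.MuLambda
  Summit.BirchSwinnertonDyer.Rank1Residual.Iwasawa

namespace Summit.BirchSwinnertonDyer.Rank1Residual.Supersingular

/-! ## §1. `e_{n+1} ≡ a_pⁿ(a_p − 1)² (mod p)` -/

section Congruence

/-- **`e_{n+1} = c_{n+2} − 2c_{n+1} + c_n ≡ a_pⁿ·(a_p − 1)² (mod p)`** (`c_j ≡ a_p^j`).
[cite: MazurTateTeitelbaum1986Invent, §I.10 Prop. (10.2) and §I.14] -/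
theorem heckeDescentSeq_secondDiff_zmod {ap : ℤ} {p : ℕ} {c : ℕ → ℤ} (hc0 : c 0 = 1)
    (hc1 : c 1 = ap) (hrec : ∀ j, c (j + 2) = ap * c (j + 1) - p * c j) (n : ℕ) :
    ((c (n + 2) - 2 * c (n + 1) + c n : ℤ) : ZMod p) =
      ((ap : ℤ) : ZMod p) ^ n * (((ap : ℤ) : ZMod p) - 1) ^ 2 := by
  push_cast
  rw [heckeDescentSeq_intCast_zmod_eq_pow hc0 hc1 hrec, heckeDescentSeq_intCast_zmod_eq_pow hc0 hc1 hrec,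
    heckeDescentSeq_intCast_zmod_eq_pow hc0 hc1 hrec]
  ring

/-- **Ordinary NON-anomalous prime: `p ∤ e_{n+1}` at every layer** (`p ∤ a_p`, `p ∤ a_p − 1`, `p` prime).
[cite: MazurTateTeitelbaum1986Invent, §I.14 (the p-adic multiplier)] -/
theorem not_dvd_heckeDescentSeq_secondDiff_of_not_anomalous {ap : ℤ} {p : ℕ} [hp : Fact p.Prime]
    {c : ℕ → ℤ} (hc0 : c 0 = 1) (hc1 : c 1 = ap)
    (hrec : ∀ j, c (j + 2) = ap * c (j + 1) - p * c j) (hord : ¬ (p : ℤ) ∣ ap)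
    (hna : ¬ (p : ℤ) ∣ ap - 1) (n : ℕ) : ¬ (p : ℤ) ∣ c (n + 2) - 2 * c (n + 1) + c n := by
  rw [← ZMod.intCast_zmod_eq_zero_iff_dvd, heckeDescentSeq_secondDiff_zmod hc0 hc1 hrec]
  have ha : ((ap : ℤ) : ZMod p) ≠ 0 := by rwa [Ne, ZMod.intCast_zmod_eq_zero_iff_dvd]
  have ha1 : ((ap : ℤ) : ZMod p) - 1 ≠ 0 := by
    rw [Ne, ← Int.cast_one, ← Int.cast_sub, ZMod.intCast_zmod_eq_zero_iff_dvd]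
    exact hna
  exact mul_ne_zero (pow_ne_zero _ ha) (pow_ne_zero _ ha1)

/-- **ANOMALOUS prime `a_p ≡ 1 (mod p)`: `p ∣ e_{n+1}` at every layer `n + 1 ≥ 1`.**
[cite: Mazur1972, §1 (anomalous primes)] [cite: MazurTateTeitelbaum1986Invent, §I.14 (the p-adic multiplier)] -/
theorem dvd_heckeDescentSeq_secondDiff_of_anomalous {ap : ℤ} {p : ℕ} {c : ℕ → ℤ} (hc0 : c 0 = 1)
    (hc1 : c 1 = ap) (hrec : ∀ j, c (j + 2) = ap * c (j + 1) - p * c j) (ha : (p : ℤ) ∣ ap - 1)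
    (n : ℕ) : (p : ℤ) ∣ c (n + 2) - 2 * c (n + 1) + c n := by
  rw [← ZMod.intCast_zmod_eq_zero_iff_dvd, heckeDescentSeq_secondDiff_zmod hc0 hc1 hrec]
  have ha1 : ((ap : ℤ) : ZMod p) - 1 = 0 := by
    rw [← Int.cast_one, ← Int.cast_sub, ZMod.intCast_zmod_eq_zero_iff_dvd]
    exact ha
  rw [ha1, zero_pow two_ne_zero, mul_zero]

/-- Anomalous prime: the layer-`0` value `e_0 = a_p − 2 ≡ −1` IS a unit (`p` prime). [cite: Mazur1972, §1 (anomalous primes)] -/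
theorem not_dvd_sub_two_of_anomalous {ap : ℤ} {p : ℕ} [hp : Fact p.Prime] (ha : (p : ℤ) ∣ ap - 1) :
    ¬ (p : ℤ) ∣ ap - 2 := by
  intro h
  have h1 : (p : ℤ) ∣ 1 := by
    have := ha.sub h
    rwa [show ap - 1 - (ap - 2) = (1 : ℤ) by ring] at this
  exact hp.out.ne_one (by exact_mod_cast Int.eq_one_of_dvd_one (Int.natCast_nonneg p) h1)

end Congruence

/-! ## §2. On the real objects: the trivial-character column at an ordinary prime -/

section Ordinary

variable {N : ℕ} [NeZero N] {f : CuspForm (Gamma0 N) 2} {p : ℕ} [hp : Fact p.Prime]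

/-- **Ordinary non-anomalous `p ∤ 2N`: `θ_{n+1}(0)` is a `p`-UNIT multiple of `[0]⁺_f` at every layer**:
`θ_{n+1}(0) = e_{n+1}·[0]⁺_f` with `p ∤ e_{n+1}`. [cite: MazurTateTeitelbaum1986Invent, §I.8 (8.6), §I.10 Prop. (10.2) and §I.14] -/
theorem eval_zero_mazurTateElement_succ_of_not_anomalous (hp2 : p ≠ 2) (hf0 : IsNewform0 f)
    (hQ : coeffField f = ⊥) (hpN : ¬ p ∣ N) {ap : ℤ} (hap : cuspCoeff f p = ap)
    (hord : ¬ (p : ℤ) ∣ ap) (hna : ¬ (p : ℤ) ∣ ap - 1) (n : ℕ) :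
    ∃ e : ℤ, ¬ (p : ℤ) ∣ e ∧
      (mazurTateElement f p (n + 1)).eval 0 = (e : ℚ) * ratPlusSymbol f 0 := by
  obtain ⟨c, hc0, hc1, hrec⟩ := exists_heckeDescentSeq ap p
  exact ⟨_, not_dvd_heckeDescentSeq_secondDiff_of_not_anomalous hc0 hc1 hrec hord hna n,
    eval_zero_mazurTateElement_succ hp2 hf0 hQ hpN hap hc0 hc1 hrec n⟩

/-- **Anomalous `p ∤ 2N` (`a_p ≡ 1 (mod p)`): `θ_{n+1}(0) ∈ p·ℤ·[0]⁺_f` at every layer `n + 1 ≥ 1`** —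
an EXTRA factor `p` at the trivial character (the finite-layer shadow of `(1 − α⁻¹)²`).
[cite: Mazur1972, §1 (anomalous primes)] [cite: MazurTateTeitelbaum1986Invent, §I.10 Prop. (10.2) and §I.14] -/
theorem eval_zero_mazurTateElement_succ_of_anomalous (hp2 : p ≠ 2) (hf0 : IsNewform0 f)
    (hQ : coeffField f = ⊥) (hpN : ¬ p ∣ N) {ap : ℤ} (hap : cuspCoeff f p = ap)
    (ha : (p : ℤ) ∣ ap - 1) (n : ℕ) :
    ∃ e' : ℤ, (mazurTateElement f p (n + 1)).eval 0 = ((p : ℚ) * e') * ratPlusSymbol f 0 := by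
  obtain ⟨c, hc0, hc1, hrec⟩ := exists_heckeDescentSeq ap p
  obtain ⟨e', he'⟩ := dvd_heckeDescentSeq_secondDiff_of_anomalous hc0 hc1 hrec ha n
  refine ⟨e', ?_⟩
  rw [eval_zero_mazurTateElement_succ hp2 hf0 hQ hpN hap hc0 hc1 hrec n, he']
  push_cast
  ring

/-- **Ordinary non-anomalous, `L(f,1) ≠ 0`: `μ(Θ) ≤ ord_p ϖ + ord_p [0]⁺_f` at EVERY layer** for an
integral model `Θ` of `ϖ·θ_{n+1}` (`ϖ ≠ 0` rational): the trivial-character coefficient alone bounds `μ`.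
[cite: GreenbergVatsal2000, p. 2, (2)] [cite: MazurTateTeitelbaum1986Invent, §I.14] -/
theorem mazurTate_mu_le_of_not_anomalous (hp2 : p ≠ 2) (hf0 : IsNewform0 f)
    (hQ : coeffField f = ⊥) (hpN : ¬ p ∣ N) {ap : ℤ} (hap : cuspCoeff f p = ap)
    (hord : ¬ (p : ℤ) ∣ ap) (hna : ¬ (p : ℤ) ∣ ap - 1) {n : ℕ} {ϖ : ℚ} (hϖ : ϖ ≠ 0)
    (hr : ratPlusSymbol f 0 ≠ 0) {Θ : IwasawaAlgebra p}
    (hΘ : iwasawaToPowerSeries p Θ = PowerSeries.C (ϖ : ℚ_[p]) *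
      ((mazurTateElement f p (n + 1)).map (algebraMap ℚ ℚ_[p]) : PowerSeries ℚ_[p])) :
    (mu Θ : ℤ) ≤ padicValRat p ϖ + padicValRat p (ratPlusSymbol f 0) := by
  obtain ⟨c, hc0, hc1, hrec⟩ := exists_heckeDescentSeq ap p
  have he := not_dvd_heckeDescentSeq_secondDiff_of_not_anomalous hc0 hc1 hrec hord hna n
  have he0 : c (n + 2) - 2 * c (n + 1) + c n ≠ 0 := fun h ↦ he (by rw [h]; exact dvd_zero _)
  have h := mazurTate_mu_le_padicValRat_constantTerm hp2 hf0 hQ hpN hap hc0 hc1 hrec hϖ hr he0 hΘ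
  rwa [padicValRat.mul hϖ (mul_ne_zero (by exact_mod_cast he0) hr),
    padicValRat.mul (by exact_mod_cast he0) hr, padicValRat.of_int, padicValInt.eq_zero_of_not_dvd he,
    Nat.cast_zero, zero_add] at h

variable {W : WeierstrassCurve ℚ} [W.IsElliptic] [W.IsGloballyMinimal]

/-- **For the newform of an elliptic curve**: `p` an odd prime of good reduction with `p ∤ a_p(W)` and
`a_p(W) ≢ 1 (mod p)` (ordinary, non-anomalous), `L(f,1) ≠ 0`: `μ(Θ) ≤ ord_p ϖ + ord_p [0]⁺_f` for every
integral model `Θ` of `ϖ·θ_{n+1}`. [cite: GreenbergVatsal2000, p. 2, (2)] [cite: MazurTateTeitelbaum1986Invent, §I.14] -/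
theorem mazurTate_mu_le_of_not_anomalous_of_isNewformOf (hp2 : p ≠ 2) (hf : IsNewformOf W f)
    (hgood : W.HasGoodReductionAtPrime p) (hord : ¬ (p : ℤ) ∣ W.frobeniusTrace p)
    (hna : ¬ (p : ℤ) ∣ W.frobeniusTrace p - 1) {n : ℕ} {ϖ : ℚ} (hϖ : ϖ ≠ 0)
    (hr : ratPlusSymbol f 0 ≠ 0) {Θ : IwasawaAlgebra p}
    (hΘ : iwasawaToPowerSeries p Θ = PowerSeries.C (ϖ : ℚ_[p]) *
      ((mazurTateElement f p (n + 1)).map (algebraMap ℚ ℚ_[p]) : PowerSeries ℚ_[p])) :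
    (mu Θ : ℤ) ≤ padicValRat p ϖ + padicValRat p (ratPlusSymbol f 0) :=
  mazurTate_mu_le_of_not_anomalous hp2 hf.1 hf.coeffField_eq_bot (not_dvd_level_of_isNewformOf hf hgood)
    (cuspCoeff_eq_frobeniusTrace_of_isNewformOf_holds hf hgood) hord hna hϖ hr hΘ

end Ordinary

/-! ## §3. The unit root: `e_{n+1} = (α − 1)²·c_n + (a_p − 2)·βⁿ⁺¹` and the EXACT valuation at an ordinary prime -/

section UnitRoot

/-- **The second difference through a root of the Hecke polynomial.** In any commutative ring, if
`α² − a_p α + p = 0` and `β := a_p − α` (so `α + β = a_p`, `αβ = p`, `c_n = Σ_{i+j=n} α^i β^j`), then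
**`e_{n+1} = c_{n+2} − 2c_{n+1} + c_n = (α − 1)²·c_n + (a_p − 2)·β^{n+1}`** for every `n`. (Both sides
solve the Hecke recursion; the two initial identities are multiples of `α² − a_p α + p`.)
[cite: MazurTateTeitelbaum1986Invent, §I.10 Prop. (10.2) and §I.14 (the p-adic multiplier)] -/
theorem heckeDescentSeq_secondDiff_eq_root {R : Type*} [CommRing R] {ap : ℤ} {p : ℕ} {c : ℕ → ℤ}
    (hc0 : c 0 = 1) (hc1 : c 1 = ap) (hrec : ∀ j, c (j + 2) = ap * c (j + 1) - p * c j) {α : R}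
    (hα : α ^ 2 - (ap : R) * α + p = 0) (n : ℕ) :
    ((c (n + 2) - 2 * c (n + 1) + c n : ℤ) : R) =
      (α - 1) ^ 2 * (c n : R) + ((ap : R) - 2) * ((ap : R) - α) ^ (n + 1) := by
  have hβ : ((ap : R) - α) ^ 2 = (ap : R) * ((ap : R) - α) - p := by linear_combination hα
  have hc2 : c 2 = ap * ap - p * 1 := by rw [hrec 0, zero_add, hc1, hc0]
  have hc3 : c 3 = ap * c 2 - p * ap := by rw [show (3 : ℕ) = 1 + 2 by rfl, hrec 1, hc1]
  have key : ∀ n, ((c (n + 2) - 2 * c (n + 1) + c n : ℤ) : R) =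
      (α - 1) ^ 2 * (c n : R) + ((ap : R) - 2) * ((ap : R) - α) ^ (n + 1) ∧
      ((c (n + 3) - 2 * c (n + 2) + c (n + 1) : ℤ) : R) =
      (α - 1) ^ 2 * (c (n + 1) : R) + ((ap : R) - 2) * ((ap : R) - α) ^ (n + 2) := by
    intro n
    induction n with
    | zero =>
      refine ⟨?_, ?_⟩
      · rw [zero_add, hc2, hc1, hc0]; push_cast; linear_combination (-1 : R) * hα
      · rw [zero_add, hc3, hc2, hc1]; push_cast; linear_combination (2 - 2 * (ap : R)) * hα
    | succ n ih =>
      refine ⟨by rw [show n + 1 + 2 = n + 3 by ring, show n + 1 + 1 = n + 2 by ring]; exact ih.2, ?_⟩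
      have hE := heckeDescentSeq_secondDiff_rec hrec n
      have hC : c (n + 2) = ap * c (n + 1) - p * c n := hrec n
      have hE' : ((c (n + 4) - 2 * c (n + 3) + c (n + 2) : ℤ) : R) =
          (ap : R) * ((c (n + 3) - 2 * c (n + 2) + c (n + 1) : ℤ) : R) -
            (p : R) * ((c (n + 2) - 2 * c (n + 1) + c n : ℤ) : R) := by
        rw [hE]; push_cast; ring
      have hC' : ((c (n + 2) : ℤ) : R) = (ap : R) * (c (n + 1) : R) - (p : R) * (c n : R) := by
        rw [hC]; push_cast; ring
      rw [show n + 1 + 3 = n + 4 by ring, show n + 1 + 2 = n + 3 by ring, show n + 1 + 1 = n + 2 by ring,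
        hE', ih.1, ih.2, hC']
      linear_combination (-((ap : R) - 2) * ((ap : R) - α) ^ (n + 1)) * hβ
  exact (key n).1

variable {p : ℕ} [hp : Fact p.Prime]

/-- **Ordinary prime: the complementary root `β = a_p − α` has `|β| = 1/p`** (`αβ = p`, `|α| = 1`).
[cite: MazurTateTeitelbaum1986Invent, §I.11 (allowable root)] -/
theorem norm_sub_root_eq_of_isUnit {ap : ℤ} {α : ℤ_[p]} (hα : α ^ 2 - (ap : ℤ_[p]) * α + p = 0)
    (hu : IsUnit α) : ‖(ap : ℤ_[p]) - α‖ = (p : ℝ)⁻¹ := by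
  have hprod : α * ((ap : ℤ_[p]) - α) = p := by linear_combination -hα
  have h := congr_arg (fun z : ℤ_[p] ↦ ‖z‖) hprod
  simp only [norm_mul, PadicInt.isUnit_iff.mp hu, one_mul, PadicInt.norm_p] at h
  exact h

/-- **Ordinary prime: `c_n` is a `p`-adic unit** (`c_n ≡ a_p^n (mod p)`, `p ∤ a_p`).
[cite: MazurTateTeitelbaum1986Invent, §I.10 Prop. (10.2)] -/
theorem norm_intCast_heckeDescentSeq_eq_one {ap : ℤ} {c : ℕ → ℤ} (hc0 : c 0 = 1) (hc1 : c 1 = ap)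
    (hrec : ∀ j, c (j + 2) = ap * c (j + 1) - p * c j) (hord : ¬ (p : ℤ) ∣ ap) (n : ℕ) :
    ‖((c n : ℤ) : ℤ_[p])‖ = 1 := by
  have hnd : ¬ (p : ℤ) ∣ c n := by
    intro h
    have h0 := heckeDescentSeq_intCast_zmod_eq_pow hc0 hc1 hrec n
    rw [(ZMod.intCast_zmod_eq_zero_iff_dvd _ p).mpr h, eq_comm] at h0
    exact hord ((ZMod.intCast_zmod_eq_zero_iff_dvd _ p).mp (pow_eq_zero_iff'.mp h0).1)
  exact le_antisymm (PadicInt.norm_le_one _) (not_lt.mp fun h ↦ hnd ((PadicInt.norm_int_lt_one_iff_dvd _).mp h))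

/-- **EXACT VALUATION OF THE TRIVIAL-CHARACTER MULTIPLIER AT AN ORDINARY PRIME.** `p ∤ a_p`, `α ∈ ℤ_p^×`
the unit root of `X² − a_pX + p`; then for every layer `n + 1` with `p^{−(n+1)} < |α − 1|²`:
**`|e_{n+1}|_p = |α − 1|²`** — i.e. `ord_p(θ_{n+1}(0)/[0]⁺_f) = 2·ord_p(1 − α)` as soon as
`n + 1 > 2·ord_p(1 − α)`: `0` at a non-anomalous prime, `≥ 2` at an ANOMALOUS one — the finite-layer
form of Mazur–Tate–Teitelbaum's `p`-adic multiplier `(1 − α⁻¹)²` (`L_p(E,0) = (1 − α⁻¹)²·L(E,1)/Ω`).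
[cite: MazurTateTeitelbaum1986Invent, §I.14 (the p-adic multiplier) and §I.11] -/
theorem norm_intCast_heckeDescentSeq_secondDiff_eq {ap : ℤ} {c : ℕ → ℤ} (hc0 : c 0 = 1)
    (hc1 : c 1 = ap) (hrec : ∀ j, c (j + 2) = ap * c (j + 1) - p * c j) (hord : ¬ (p : ℤ) ∣ ap)
    {α : ℤ_[p]} (hα : α ^ 2 - (ap : ℤ_[p]) * α + p = 0) (hu : IsUnit α) {n : ℕ}
    (hn : ((p : ℝ)⁻¹) ^ (n + 1) < ‖α - 1‖ ^ 2) :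
    ‖((c (n + 2) - 2 * c (n + 1) + c n : ℤ) : ℤ_[p])‖ = ‖α - 1‖ ^ 2 := by
  rw [heckeDescentSeq_secondDiff_eq_root hc0 hc1 hrec hα n]
  have h1 : ‖(α - 1) ^ 2 * ((c n : ℤ) : ℤ_[p])‖ = ‖α - 1‖ ^ 2 := by
    rw [norm_mul, norm_pow, norm_intCast_heckeDescentSeq_eq_one hc0 hc1 hrec hord n, mul_one]
  have h2 : ‖((ap : ℤ_[p]) - 2) * ((ap : ℤ_[p]) - α) ^ (n + 1)‖ ≤ ((p : ℝ)⁻¹) ^ (n + 1) := by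
    rw [norm_mul, norm_pow, norm_sub_root_eq_of_isUnit hα hu]
    exact mul_le_of_le_one_left (by positivity) (PadicInt.norm_le_one _)
  have hne : ‖(α - 1) ^ 2 * ((c n : ℤ) : ℤ_[p])‖ ≠ ‖((ap : ℤ_[p]) - 2) * ((ap : ℤ_[p]) - α) ^ (n + 1)‖ := by
    rw [h1]; exact (ne_of_lt (lt_of_le_of_lt h2 hn)).symm
  rw [PadicInt.norm_add_eq_max_of_ne hne, h1, max_eq_left]
  rw [← h1]
  exact le_of_lt (lt_of_le_of_lt h2 (h1 ▸ hn))

/-- Non-anomalous form (`|α − 1| = 1 ⟺ p ∤ a_p − 1`): `|e_{n+1}| = 1` at every layer — §1 again, now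
through the unit root. [cite: MazurTateTeitelbaum1986Invent, §I.14 (the p-adic multiplier)] -/
theorem norm_unitRoot_sub_one_eq_one_iff {ap : ℤ} {α : ℤ_[p]} (hα : α ^ 2 - (ap : ℤ_[p]) * α + p = 0)
    (hu : IsUnit α) : ‖α - 1‖ = 1 ↔ ¬ (p : ℤ) ∣ ap - 1 := by
  -- `α − 1 = (a_p − 1) − β` with `|β| = 1/p < 1`
  have hβ : ‖(ap : ℤ_[p]) - α‖ < 1 := by
    rw [norm_sub_root_eq_of_isUnit hα hu]
    exact inv_lt_one_of_one_lt₀ (by exact_mod_cast hp.out.one_lt)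
  have heq : α - 1 = (((ap - 1 : ℤ) : ℤ_[p])) + -((ap : ℤ_[p]) - α) := by push_cast; ring
  rw [← PadicInt.norm_int_lt_one_iff_dvd, not_lt]
  constructor
  · intro h
    by_contra hlt
    push Not at hlt
    have : ‖α - 1‖ < 1 := by
      rw [heq]
      exact lt_of_le_of_lt (PadicInt.nonarchimedean _ _) (max_lt hlt (by rwa [norm_neg]))
    exact absurd h (ne_of_lt this)
  · intro h
    have h1 : ‖(((ap - 1 : ℤ) : ℤ_[p]))‖ = 1 := le_antisymm (PadicInt.norm_le_one _) h
    rw [heq, PadicInt.norm_add_eq_max_of_ne (by rw [h1, norm_neg]; exact (ne_of_lt hβ).symm), h1, norm_neg]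
    exact max_eq_left (le_of_lt hβ)

variable {N : ℕ} [NeZero N] {f : CuspForm (Gamma0 N) 2} {W : WeierstrassCurve ℚ} [W.IsElliptic]
  [W.IsGloballyMinimal]

/-- **On the real objects (the newform of an elliptic curve at a good ORDINARY odd prime):** with
`α = unitRoot W p` (`α² − a_pα + p = 0`, `α ∈ ℤ_p^×`, `unitRoot_spec_holds`) and `[0]⁺_f ≠ 0`, for every
layer `n + 1` with `p^{−(n+1)} < |α − 1|²`:
**`|θ_{n+1}(0)|_p = |α − 1|² · |[0]⁺_f|_p`**, i.e. `ord_p θ_{n+1}(0) = 2·ord_p(1 − α) + ord_p[0]⁺_f`.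
[cite: MazurTateTeitelbaum1986Invent, §I.14 (the p-adic multiplier), §I.11 and §I.10 Prop. (10.2)] -/
theorem norm_eval_zero_mazurTateElement_succ_of_isOrdinaryAt (hp2 : p ≠ 2) (hf : IsNewformOf W f)
    (hord : IsOrdinaryAt W p) {n : ℕ}
    (hn : ((p : ℝ)⁻¹) ^ (n + 1) < ‖unitRoot W p - 1‖ ^ 2) :
    ‖(((mazurTateElement f p (n + 1)).eval 0 : ℚ) : ℚ_[p])‖ =
      ‖unitRoot W p - 1‖ ^ 2 * ‖((ratPlusSymbol f 0 : ℚ) : ℚ_[p])‖ := by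
  obtain ⟨hα, hu⟩ := unitRoot_spec_holds W p hord
  obtain ⟨c, hc0, hc1, hrec⟩ := exists_heckeDescentSeq (W.frobeniusTrace p) p
  rw [eval_zero_mazurTateElement_succ hp2 hf.1 hf.coeffField_eq_bot (not_dvd_level_of_isNewformOf hf hord.1)
    (cuspCoeff_eq_frobeniusTrace_of_isNewformOf_holds hf hord.1) hc0 hc1 hrec n]
  push_cast
  rw [norm_mul, ← norm_intCast_heckeDescentSeq_secondDiff_eq hc0 hc1 hrec hord.2 hα hu hn,
    PadicInt.norm_def]
  push_cast
  rfl

end UnitRoot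

end Summit.BirchSwinnertonDyer.Rank1Residual.Supersingular

end
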